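import Summits.QuantumFields.BalabanUV.T4Continuum.Support.DirichletDipCutoffAxis

/-!
# `BalabanUV.T4Continuum.Support.DirichletDipSmoothPart` — NE2 (node U1a) formalisation swarm, sub-row `T4-U1a.S-NE2-D1-DIRICHLET°`, supplier item
# «Δ1-SKELETON» (file 5): THE SMOOTH PART `Gs = [−μ-exposed] · hV · Π_κ W_κ` OF A DIP IS UNCONDITIONALLY SMOOTH — `|ΔGs| ≤ 2·lip1 R`,
# `|Δ²Gs| ≤ 2·lip2 R` along every axis at every site of the torus, and `Gs` is EXACTLY continuous across every block face; all the
# non-smoothness of a dip sits in its connection indicator (unit b2b-balaban-t4-ne2-formalise-leaf-08, gen 7, file 5)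

HONEST FRAMING.  Rung (B)+1 bookkeeping at MODEL level, finite torus; pure lattice combinatorics; NE2 (U1a) is NOT proved by this file;
spine PROVED 0/9 unchanged; NOT infinite volume, NOT the mass gap, NOT Clay.  HONEST DEPENDENCY (verbatim): «continuum YM on T⁴ ⇐ BetaPertH ∧
nine spine estimates (0/9 proved); BetaPertH ⇐ (D1) ∧ (D4) ∧ CAP+tail; G-an2-4 gates asym, D1 and NE2/3/4.»

WHAT THIS FILE PROVES (0 sorry; file 4's axis-profile lemmas BY NAME): `one_ne_zero_of_botExp` (an exposed block forces `M_μ ≥ 2`),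
`hV_step_mu` ∕ `hV_second_mu` ∕ `hV_cross_mu` ∕ `hV_add_of_ne`, `Wax_step` ∕ `Wax_second` ∕ `Wax_cross` ∕ `Wax_add_of_ne`, `Ptr_cross`,
`Ptr_add_mu`, the split `Ptr = W_κ · Prest_κ` with `Prest_κ` constant along `κ`, and the three END lemmas **`Gs_cross`**, **`Gs_step`**,
**`Gs_second`** (`2 ≤ R`, `4R ≤ n`; no hypothesis on `S`, on the site, or on the torus).

ABSOLUTE RULE (cell, verbatim): «No internally-minted statement may enter as a cited fact. Every hypothesis is either kernel-proved in
this package or a verbatim quotation of a PUBLISHED theorem with page reference. The manuscript(s) under audit are NOT citable for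
their own disputed steps — they are the thing under adjudication; programme-internal (2001/route/tribunal) claims are never citable.»
[folklore] lattice bookkeeping; one data definition (`Prest`); no `def … : Prop` fact.  NOT CLAIMED: the smoothness of `psiS` (next file); NE2; NE3.
-/

noncomputable section

open scoped BigOperators
open Finset

namespace Summit.QuantumFields.BalabanUV.T4Continuum.DirichletDipCutoffAxis

open Literature.MathematicalPhysics.QuantumFieldTheory.Balaban1983to89.B5Prop11Plancherel (Tor fine unitVec)
open Literature.MathematicalPhysics.QuantumFieldTheory.Balaban1983to89.B5Blocks16 (blockOf)
open Summit.QuantumFields.BalabanUV.T4Continuum.DirichletMonotoneCutoff (offsF)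
open Summit.QuantumFields.BalabanUV.T4Continuum.ScaleProfile (lip1 lip2 lip1_nonneg lip2_nonneg prod_mem)
open Summit.QuantumFields.BalabanUV.T4Continuum.DirichletDipCutoff (BotExp hV Wax Ptr Gs hV_mem Wax_mem Ptr_mem Gs_eq_of_botExp
  Gs_eq_zero_of_not_botExp)

variable {d : ℕ} (n : ℕ) [NeZero n] (M : Fin d → ℕ) [hM : ∀ μ, NeZero (M μ)]

/-! ## §3 The smooth part of a dip is smooth along every axis, at every site -/

/-- a scalar factor in `[0,1]` does not increase a first difference. [folklore] -/
theorem abs_mul_sub_le {a u v : ℝ} (h0 : 0 ≤ a) (h1 : a ≤ 1) : |a * u - a * v| ≤ |u - v| := by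
  rw [← mul_sub, abs_mul, abs_of_nonneg h0]; exact mul_le_of_le_one_left (abs_nonneg _) h1

/-- … nor a second difference. [folklore] -/
theorem abs_mul_second_le {a u v w : ℝ} (h0 : 0 ≤ a) (h1 : a ≤ 1) : |2 * (a * u) - a * v - a * w| ≤ |2 * u - v - w| := by
  rw [show 2 * (a * u) - a * v - a * w = a * (2 * u - v - w) by ring, abs_mul, abs_of_nonneg h0]
  exact mul_le_of_le_one_left (abs_nonneg _) h1

/-- the rest of the transversal product after taking out the window along `κ`. [folklore] -/
def Prest (μ : Fin d) (R : ℕ) (β : Tor M) (κ : Fin d) (x : Tor (fine n M)) : ℝ := ∏ lam ∈ (univ.erase μ).erase κ, Wax n M R β lam x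

section Smooth

variable {n M} {S : Tor M → Prop} [DecidablePred S] {μ : Fin d} {R : ℕ} (hR : 2 ≤ R) (hn : 4 * R ≤ n) (β : Tor M)

omit [NeZero n] hM [DecidablePred S] in
/-- a `−μ`-exposed block lives on a torus with at least two layers along `μ`: `1 ≠ 0` in `ZMod (M μ)`. [folklore] -/
theorem one_ne_zero_of_botExp {β : Tor M} (h : BotExp M S μ β) : (1 : ZMod (M μ)) ≠ 0 := by
  intro h1
  have : unitVec M μ = 0 := by
    funext ν; by_cases hν : ν = μ
    · subst hν; simp [unitVec, h1]
    · simp [unitVec, Pi.single_eq_of_ne hν]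
  exact h.2 (by rw [this, sub_zero]; exact h.1)

include hR hn

omit [DecidablePred S] in
/-- the height factor: steps `≤ lip1 R` along `μ` (for an exposed block). [folklore] -/
theorem hV_step_mu (hBE : BotExp M S μ β) (x : Tor (fine n M)) :
    |hV n M μ R β (x + unitVec (fine n M) μ) - hV n M μ R β x| ≤ lip1 R := by
  rw [hV_eq_liftA, hV_eq_liftA]
  exact liftA_step μ (axisSmooth_hVp (n := n) hR hn (one_ne_zero_of_botExp hBE) (β μ)) x

omit [DecidablePred S] in
/-- the height factor: second differences `≤ lip2 R` along `μ`. [folklore] -/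
theorem hV_second_mu (hBE : BotExp M S μ β) (x : Tor (fine n M)) :
    |2 * hV n M μ R β x - hV n M μ R β (x + unitVec (fine n M) μ) - hV n M μ R β (x - unitVec (fine n M) μ)| ≤ lip2 R := by
  rw [hV_eq_liftA, hV_eq_liftA, hV_eq_liftA]
  exact liftA_second μ (axisSmooth_hVp (n := n) hR hn (one_ne_zero_of_botExp hBE) (β μ)) (by omega) x

omit hR hn in
/-- the height factor is constant along `κ ≠ μ`. [folklore] -/
theorem hV_add_of_ne {κ : Fin d} (hκ : κ ≠ μ) (x : Tor (fine n M)) : hV n M μ R β (x + unitVec (fine n M) κ) = hV n M μ R β x := by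
  rw [hV_eq_liftA, hV_eq_liftA]; exact liftA_add_of_ne μ _ hκ x

omit hR hn in
/-- … and backwards. [folklore] -/
theorem hV_sub_of_ne {κ : Fin d} (hκ : κ ≠ μ) (x : Tor (fine n M)) : hV n M μ R β (x - unitVec (fine n M) κ) = hV n M μ R β x := by
  rw [hV_eq_liftA, hV_eq_liftA]; exact liftA_sub_of_ne μ _ hκ x

omit [DecidablePred S] in
/-- the height factor across the `μ`-face (exposed block): exact continuity. [folklore] -/
theorem hV_cross_mu (hBE : BotExp M S μ β) {x : Tor (fine n M)} (h : (offsF n M x μ : ℕ) + 1 = n) :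
    hV n M μ R β (x + unitVec (fine n M) μ) = hV n M μ R β x := by
  rw [hV_eq_liftA, hV_eq_liftA]
  exact liftA_cross μ (axisSmooth_hVp (n := n) hR hn (one_ne_zero_of_botExp hBE) (β μ)) h

omit hR hn in
/-- a window is constant along the other axes. [folklore] -/
theorem Wax_add_of_ne {κ lam : Fin d} (h : lam ≠ κ) (x : Tor (fine n M)) :
    Wax n M R β κ (x + unitVec (fine n M) lam) = Wax n M R β κ x := by
  rw [Wax_eq_liftA, Wax_eq_liftA]; exact liftA_add_of_ne κ _ h x

omit hR hn in
/-- … and backwards. [folklore] -/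
theorem Wax_sub_of_ne {κ lam : Fin d} (h : lam ≠ κ) (x : Tor (fine n M)) :
    Wax n M R β κ (x - unitVec (fine n M) lam) = Wax n M R β κ x := by
  rw [Wax_eq_liftA, Wax_eq_liftA]; exact liftA_sub_of_ne κ _ h x

/-- a window along its own axis: steps `≤ 2·lip1 R`. [folklore] -/
theorem Wax_step (κ : Fin d) (x : Tor (fine n M)) :
    |Wax n M R β κ (x + unitVec (fine n M) κ) - Wax n M R β κ x| ≤ 2 * lip1 R := by
  rw [Wax_eq_liftA, Wax_eq_liftA]; exact liftA_step κ (axisSmooth_Wp (n := n) hR hn (β κ)) x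

/-- a window along its own axis: second differences `≤ 2·lip2 R`. [folklore] -/
theorem Wax_second (κ : Fin d) (x : Tor (fine n M)) :
    |2 * Wax n M R β κ x - Wax n M R β κ (x + unitVec (fine n M) κ) - Wax n M R β κ (x - unitVec (fine n M) κ)| ≤ 2 * lip2 R := by
  rw [Wax_eq_liftA, Wax_eq_liftA, Wax_eq_liftA]; exact liftA_second κ (axisSmooth_Wp (n := n) hR hn (β κ)) (by omega) x

/-- a window across its own face: exact continuity. [folklore] -/
theorem Wax_cross {κ : Fin d} {x : Tor (fine n M)} (h : (offsF n M x κ : ℕ) + 1 = n) :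
    Wax n M R β κ (x + unitVec (fine n M) κ) = Wax n M R β κ x := by
  rw [Wax_eq_liftA, Wax_eq_liftA]; exact liftA_cross κ (axisSmooth_Wp (n := n) hR hn (β κ)) h

/-- **`Ptr` across any face: exact continuity.** [folklore] -/
theorem Ptr_cross {κ : Fin d} {x : Tor (fine n M)} (h : (offsF n M x κ : ℕ) + 1 = n) :
    Ptr n M μ R β (x + unitVec (fine n M) κ) = Ptr n M μ R β x := by
  unfold Ptr
  refine Finset.prod_congr rfl fun lam _ => ?_
  by_cases hl : lam = κ
  · subst hl; exact Wax_cross hR hn β h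
  · exact Wax_add_of_ne β (Ne.symm hl) x

omit hR hn in
/-- `Ptr` is constant along `μ`. [folklore] -/
theorem Ptr_add_mu (x : Tor (fine n M)) : Ptr n M μ R β (x + unitVec (fine n M) μ) = Ptr n M μ R β x := by
  unfold Ptr
  exact Finset.prod_congr rfl fun lam hl => Wax_add_of_ne β (Finset.ne_of_mem_erase hl).symm x

omit hR hn in
/-- … and backwards. [folklore] -/
theorem Ptr_sub_mu (x : Tor (fine n M)) : Ptr n M μ R β (x - unitVec (fine n M) μ) = Ptr n M μ R β x := by
  have := Ptr_add_mu (μ := μ) (R := R) β (x - unitVec (fine n M) μ)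
  rw [sub_add_cancel] at this; exact this.symm

omit hR hn in
/-- `Ptr = W_κ · Prest_κ` for `κ ≠ μ`. [folklore] -/
theorem Ptr_eq_mul_Prest {κ : Fin d} (hκ : κ ≠ μ) (x : Tor (fine n M)) :
    Ptr n M μ R β x = Wax n M R β κ x * Prest n M μ R β κ x := by
  unfold Ptr Prest
  rw [Finset.mul_prod_erase (univ.erase μ) (fun lam => Wax n M R β lam x) (Finset.mem_erase.mpr ⟨hκ, Finset.mem_univ κ⟩)]

/-- `0 ≤ Prest ≤ 1`. [folklore] -/
theorem Prest_mem (κ : Fin d) (x : Tor (fine n M)) : 0 ≤ Prest n M μ R β κ x ∧ Prest n M μ R β κ x ≤ 1 :=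
  ScaleProfile.prod_mem _ fun lam _ => Wax_mem hR hn β lam x

omit hR hn in
/-- `Prest_κ` is constant along `κ`. [folklore] -/
theorem Prest_add (κ : Fin d) (x : Tor (fine n M)) : Prest n M μ R β κ (x + unitVec (fine n M) κ) = Prest n M μ R β κ x := by
  unfold Prest
  exact Finset.prod_congr rfl fun lam hl => Wax_add_of_ne β (Finset.ne_of_mem_erase hl).symm x

omit hR hn in
/-- … and backwards. [folklore] -/
theorem Prest_sub (κ : Fin d) (x : Tor (fine n M)) : Prest n M μ R β κ (x - unitVec (fine n M) κ) = Prest n M μ R β κ x := by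
  have := Prest_add (μ := μ) (R := R) β κ (x - unitVec (fine n M) κ)
  rw [sub_add_cancel] at this; exact this.symm

/-- **`Gs` ACROSS ANY FACE: exact continuity** `Gs(x + e_κ) = Gs x` when `x` is on the last `κ`-layer of its block. [folklore] -/
theorem Gs_cross (κ : Fin d) {x : Tor (fine n M)} (h : (offsF n M x κ : ℕ) + 1 = n) :
    Gs n M S μ R β (x + unitVec (fine n M) κ) = Gs n M S μ R β x := by
  by_cases hBE : BotExp M S μ β
  · rw [Gs_eq_of_botExp hBE, Gs_eq_of_botExp hBE, Ptr_cross hR hn β h]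
    by_cases hκ : κ = μ
    · subst hκ; rw [hV_cross_mu hR hn β hBE h]
    · rw [hV_add_of_ne β hκ]
  · rw [Gs_eq_zero_of_not_botExp hBE, Gs_eq_zero_of_not_botExp hBE]

/-- **`Gs` STEPS: `|Gs(x + e_κ) − Gs x| ≤ 2·lip1 R` along every axis, at every site.** [folklore] -/
theorem Gs_step (κ : Fin d) (x : Tor (fine n M)) :
    |Gs n M S μ R β (x + unitVec (fine n M) κ) - Gs n M S μ R β x| ≤ 2 * lip1 R := by
  have hl1 := lip1_nonneg hR
  by_cases hBE : BotExp M S μ β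
  · rw [Gs_eq_of_botExp hBE, Gs_eq_of_botExp hBE]
    by_cases hκ : κ = μ
    · subst hκ
      rw [Ptr_add_mu β, mul_comm (hV n M κ R β (x + _)), mul_comm (hV n M κ R β x)]
      have hP := Ptr_mem hR hn (μ := κ) β x
      exact (abs_mul_sub_le hP.1 hP.2).trans ((hV_step_mu hR hn β hBE x).trans (by linarith))
    · rw [hV_add_of_ne β hκ, Ptr_eq_mul_Prest β hκ, Ptr_eq_mul_Prest β hκ, Prest_add β κ x]
      have hv := hV_mem hR (n := n) (M := M) (μ := μ) β x
      have hp := Prest_mem hR hn (μ := μ) β κ x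
      rw [show hV n M μ R β x * (Wax n M R β κ (x + unitVec (fine n M) κ) * Prest n M μ R β κ x)
            = (hV n M μ R β x * Prest n M μ R β κ x) * Wax n M R β κ (x + unitVec (fine n M) κ) by ring,
          show hV n M μ R β x * (Wax n M R β κ x * Prest n M μ R β κ x) = (hV n M μ R β x * Prest n M μ R β κ x) * Wax n M R β κ x by ring]
      exact (abs_mul_sub_le (mul_nonneg hv.1 hp.1) (mul_le_one₀ hv.2 hp.1 hp.2)).trans (Wax_step hR hn β κ x)
  · rw [Gs_eq_zero_of_not_botExp hBE, Gs_eq_zero_of_not_botExp hBE, sub_self, abs_zero]; positivity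

/-- **`Gs` SECOND DIFFERENCES: `|2Gs x − Gs(x + e_κ) − Gs(x − e_κ)| ≤ 2·lip2 R` along every axis, at every site.** [folklore] -/
theorem Gs_second (κ : Fin d) (x : Tor (fine n M)) :
    |2 * Gs n M S μ R β x - Gs n M S μ R β (x + unitVec (fine n M) κ) - Gs n M S μ R β (x - unitVec (fine n M) κ)| ≤ 2 * lip2 R := by
  have hl2 : 0 ≤ lip2 R := lip2_nonneg
  by_cases hBE : BotExp M S μ β
  · rw [Gs_eq_of_botExp hBE, Gs_eq_of_botExp hBE, Gs_eq_of_botExp hBE]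
    by_cases hκ : κ = μ
    · subst hκ
      rw [Ptr_add_mu β, Ptr_sub_mu β, mul_comm (hV n M κ R β (x + _)), mul_comm (hV n M κ R β (x - _)), mul_comm (hV n M κ R β x)]
      have hP := Ptr_mem hR hn (μ := κ) β x
      exact (abs_mul_second_le hP.1 hP.2).trans ((hV_second_mu hR hn β hBE x).trans (by linarith))
    · rw [hV_add_of_ne β hκ, hV_sub_of_ne β hκ, Ptr_eq_mul_Prest β hκ, Ptr_eq_mul_Prest β hκ, Ptr_eq_mul_Prest β hκ,
        Prest_add β κ x, Prest_sub β κ x]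
      have hv := hV_mem hR (n := n) (M := M) (μ := μ) β x
      have hp := Prest_mem hR hn (μ := μ) β κ x
      rw [show hV n M μ R β x * (Wax n M R β κ x * Prest n M μ R β κ x) = (hV n M μ R β x * Prest n M μ R β κ x) * Wax n M R β κ x by ring,
        show hV n M μ R β x * (Wax n M R β κ (x + unitVec (fine n M) κ) * Prest n M μ R β κ x)
          = (hV n M μ R β x * Prest n M μ R β κ x) * Wax n M R β κ (x + unitVec (fine n M) κ) by ring,
        show hV n M μ R β x * (Wax n M R β κ (x - unitVec (fine n M) κ) * Prest n M μ R β κ x)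
          = (hV n M μ R β x * Prest n M μ R β κ x) * Wax n M R β κ (x - unitVec (fine n M) κ) by ring]
      exact (abs_mul_second_le (mul_nonneg hv.1 hp.1) (mul_le_one₀ hv.2 hp.1 hp.2)).trans (Wax_second hR hn β κ x)
  · rw [Gs_eq_zero_of_not_botExp hBE, Gs_eq_zero_of_not_botExp hBE, Gs_eq_zero_of_not_botExp hBE]; norm_num; positivity

end Smooth

end Summit.QuantumFields.BalabanUV.T4Continuum.DirichletDipCutoffAxis

end
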